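import Literature.NumberTheory.Transcendental.PeriodicLValueCotangentCriterion
import Literature.NumberTheory.Transcendental.BakerBirchWirsingProofs
import HarnessLib

/-!
# Murty–Saradha 2010, Theorem 7: Erdős's conjecture `Σ f(n)/n ≠ 0` for `q ≡ 3 (mod 4)`

Topic `Literature/NumberTheory/Transcendental`. Proofs only (no definitions, no named facts); sequel
of `PeriodicLValueCotangentCriterion.lean` (Theorem 5 / Corollary 6).

M. Ram Murty and N. Saradha, *Euler–Lehmer constants and a conjecture of Erdős*, J. Number Theory
130 (2010) 2671–2682 [MurtySaradha2010], §1: «Erdös conjectured (see [9]) that if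
`f : ℤ/qℤ → ℚ` with `f(a) = ±1` and `f(q) = 0`, then `Σ_{n=1}^{∞} f(n)/n ≠ 0`. … **Theorem 7.** If
`q ≡ 3 (mod 4)`, then the Erdös conjecture is true.» The printed proof (§9) reads Theorem 5's
coefficient `(1/q) Σ_{b=1}^{q−1} f(b)/(1 − ζ^b)` «modulo `2𝒪_K`», where
`Σ_{b=1}^{q−1} 1/(1 − ζ^b) = (q−1)/2` is odd. HERE that sentence is replaced by the following
rigorous bookkeeping (disclosed): with `M = {b : f(b) = −1}`,
`Σ_b f(b)/(1 − ζ^b) = (q−1)/2 − 2 Σ_{b∈M} 1/(1 − ζ^b)`, and each `q/(1 − ζ^b) = Σ_{k<q} Σ_{i<k} ζ^{bi}`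
(`ζ^{bq} = 1`, geometric sums) is an algebraic INTEGER; were the coefficient zero, the rational
number `q(q−1)/4` would be an algebraic integer, i.e. an integer — impossible for `q ≡ 3 (mod 4)`.
Then Theorem 5 (`transcendental_LFunction_one_of_ne_zero`) makes `L(1,f)` transcendental, so
non-zero; if instead `Σ_a f(a) ≠ 0` the series diverges (`PeriodicLSeries.not_tendsto_sum_range_div`,
P1 g53), so in every case `Σ f(n)/n` does not sum to `0` — `erdos_conjecture_three_mod_four`.

Cell pub-zeta5 (HONEST FRAMING: systematic search; no irrationality claim unless certified): a
printed 2010 theorem made a kernel theorem on the tree's proved Baker theorem; nothing here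
concerns `ζ(5)`; the case `q ≡ 1 (mod 4)` of Erdős's conjecture stays OPEN (not typed here).
-/

noncomputable section

open Complex Finset Filter Topology Polynomial
open Literature.NumberTheory.LFunctions.PeriodicLSeries (tendsto_sum_range_div
  not_tendsto_sum_range_div)

namespace Literature.NumberTheory.Transcendental

namespace MurtySaradha2010

variable {N : ℕ} [NeZero N]

/-! ### Cyclotomic bookkeeping: `1/(1 − ζ^b)` -/

omit [NeZero N] in
/-- `(e^{2πib/N})^N = 1`. [folklore] -/
private theorem cexp_pow_eq_one (b : ℕ) : cexp (2 * Real.pi * I * b / N) ^ N = 1 := by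
  rcases Nat.eq_zero_or_pos N with hN | hN
  · subst hN; simp
  · have hNC : (N : ℂ) ≠ 0 := by exact_mod_cast hN.ne'
    rw [← Complex.exp_nat_mul, show (N : ℂ) * (2 * Real.pi * I * b / N) = b * (2 * Real.pi * I) by
      field_simp]
    exact Complex.exp_nat_mul_two_pi_mul_I b

omit [NeZero N] in
/-- `e^{2πib/N} ≠ 1` for `1 ≤ b < N`. [folklore] -/
private theorem cexp_ne_one {b : ℕ} (hb : 1 ≤ b) (hbN : b < N) :
    cexp (2 * Real.pi * I * b / N) ≠ 1 := by
  have hN : 0 < N := by omega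
  have hNC : (N : ℂ) ≠ 0 := by exact_mod_cast hN.ne'
  intro h
  obtain ⟨n, hn⟩ := Complex.exp_eq_one_iff.1 h
  have hπ : (Real.pi : ℂ) ≠ 0 := by exact_mod_cast Real.pi_ne_zero
  have h2 : (b : ℂ) = n * N := by
    field_simp at hn
    linear_combination hn
  have h3 : (b : ℤ) = n * N := by
    have h := congrArg Complex.re h2
    simp only [Complex.natCast_re, Complex.mul_re, Complex.intCast_re, Complex.intCast_im,
      Complex.natCast_im, mul_zero, sub_zero] at h
    exact_mod_cast h
  have hb1 : (1 : ℤ) ≤ b := by exact_mod_cast hb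
  have hbN' : (b : ℤ) < N := by exact_mod_cast hbN
  have h4 : 0 < n := by
    by_contra hle
    have hle' : n ≤ 0 := not_lt.1 hle
    nlinarith
  nlinarith

omit [NeZero N] in
/-- `e^{2πi(N−b)/N} = (e^{2πib/N})⁻¹` for `b ≤ N`. [folklore] -/
private theorem cexp_sub_eq_inv {b : ℕ} (hbN : b ≤ N) (hN : 0 < N) :
    cexp (2 * Real.pi * I * ((N - b : ℕ) : ℂ) / N) = (cexp (2 * Real.pi * I * b / N))⁻¹ := by
  have hNC : (N : ℂ) ≠ 0 := by exact_mod_cast hN.ne'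
  rw [Nat.cast_sub hbN, show 2 * Real.pi * I * ((N : ℂ) - b) / N =
    2 * Real.pi * I - 2 * Real.pi * I * b / N by field_simp, Complex.exp_sub,
    Complex.exp_two_pi_mul_I, one_div]

omit [NeZero N] in
/-- **`Σ_{b=1}^{N−1} 1/(1 − ζ^b) = (N−1)/2`** for `ζ = e^{2πi/N}`, `N ≥ 1` (pair `b` with `N − b`:
`1/(1 − z) + 1/(1 − z⁻¹) = 1`). [cite: MurtySaradha2010, §9 (proof of Theorem 7)] -/
theorem sum_one_div_one_sub_cexp (hN : 0 < N) :
    ∑ b ∈ Ico 1 N, 1 / (1 - cexp (2 * Real.pi * I * b / N)) = ((N : ℂ) - 1) / 2 := by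
  set w : ℕ → ℂ := fun b => 1 / (1 - cexp (2 * Real.pi * I * b / N)) with hw
  -- reflection `b ↦ N − b`
  have hrefl : ∑ b ∈ Ico 1 N, w (N - b) = ∑ b ∈ Ico 1 N, w b := by
    have h := Finset.sum_Ico_reflect w 1 (Nat.le_succ N)
    rwa [Nat.add_sub_cancel_left, Nat.add_sub_cancel] at h
  -- the pairs
  have hpair : ∀ b ∈ Ico 1 N, w b + w (N - b) = 1 := by
    intro b hb
    obtain ⟨hb1, hbN⟩ := mem_Ico.1 hb
    have hz1 : cexp (2 * Real.pi * I * b / N) ≠ 1 := cexp_ne_one hb1 hbN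
    have hz0 : cexp (2 * Real.pi * I * b / N) ≠ 0 := Complex.exp_ne_zero _
    simp only [hw]
    rw [cexp_sub_eq_inv hbN.le hN]
    have h1 : (1 : ℂ) - cexp (2 * Real.pi * I * b / N) ≠ 0 := sub_ne_zero.2 hz1.symm
    have h2 : (1 : ℂ) - (cexp (2 * Real.pi * I * b / N))⁻¹ ≠ 0 := by
      rw [sub_ne_zero, ne_comm]; exact fun h => hz1 (inv_eq_one.1 h)
    field_simp
    ring
  have h2 : 2 * ∑ b ∈ Ico 1 N, w b = (N : ℂ) - 1 :=
    calc 2 * ∑ b ∈ Ico 1 N, w b = ∑ b ∈ Ico 1 N, w b + ∑ b ∈ Ico 1 N, w (N - b) := by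
          rw [two_mul, hrefl]
      _ = ∑ b ∈ Ico 1 N, (w b + w (N - b)) := Finset.sum_add_distrib.symm
      _ = ∑ b ∈ Ico 1 N, (1 : ℂ) := Finset.sum_congr rfl hpair
      _ = (N : ℂ) - 1 := by simp [Nat.cast_sub hN]
  change ∑ b ∈ Ico 1 N, w b = _
  linear_combination h2 / 2

omit [NeZero N] in
/-- `N/(1 − z) = Σ_{k<N} Σ_{i<k} z^i` for `z^N = 1`, `z ≠ 1`. [folklore] -/
private theorem natCast_div_one_sub_eq {z : ℂ} (hz : z ^ N = 1) (hz1 : z ≠ 1) :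
    (N : ℂ) / (1 - z) = ∑ k ∈ range N, ∑ i ∈ range k, z ^ i := by
  have h1 : (1 : ℂ) - z ≠ 0 := sub_ne_zero.2 (Ne.symm hz1)
  rw [div_eq_iff h1, Finset.sum_mul]
  have hk : ∀ k ∈ range N, (∑ i ∈ range k, z ^ i) * (1 - z) = 1 - z ^ k := by
    intro k _
    linear_combination -geom_sum_mul z k
  rw [Finset.sum_congr rfl hk, Finset.sum_sub_distrib, geom_sum_eq hz1, hz]
  simp

omit [NeZero N] in
/-- **`N/(1 − ζ^b)` is an algebraic integer** (`ζ^b` an `N`-th root of unity `≠ 1`).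
[cite: MurtySaradha2010, §9 (proof of Theorem 7, «modulo 2𝒪_K»)] -/
theorem isIntegral_natCast_div_one_sub {z : ℂ} (hz : z ^ N = 1) (hz1 : z ≠ 1) :
    IsIntegral ℤ ((N : ℂ) / (1 - z)) := by
  rcases Nat.eq_zero_or_pos N with hN0 | hN0
  · subst hN0
    simp only [Nat.cast_zero, zero_div]
    exact isIntegral_zero
  have hN : N ≠ 0 := hN0.ne'
  rw [natCast_div_one_sub_eq hz hz1]
  have hzint : IsIntegral ℤ z := by
    refine ⟨X ^ N - C 1, monic_X_pow_sub_C 1 hN, ?_⟩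
    simp [hz]
  exact IsIntegral.sum _ fun k _ => IsIntegral.sum _ fun i _ => hzint.pow i

/-- A rational number that is an algebraic integer (in `ℂ`) is an integer. [folklore] -/
private theorem exists_int_of_isIntegral {r : ℚ} (h : IsIntegral ℤ ((r : ℚ) : ℂ)) : ∃ y : ℤ, (y : ℚ) = r := by
  have h' : IsIntegral ℤ r :=
    (isIntegral_algebraMap_iff (R := ℤ) (A := ℚ) (B := ℂ) (algebraMap ℚ ℂ).injective).mp h
  obtain ⟨y, hy⟩ := IsIntegrallyClosed.algebraMap_eq_of_integral h'
  exact ⟨y, by simpa using hy⟩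

/-! ### The coefficient (11) does not vanish for `q ≡ 3 (mod 4)` -/

omit [NeZero N] in
/-- **The heart of Theorem 7.** For `N ≡ 3 (mod 4)` and `f : ℤ/N → ℂ` with `f(b) = ±1` for every
`b ≠ 0`: `Σ_{b=1}^{N−1} f(b)/(1 − ζ^b) ≠ 0` (`ζ = e^{2πi/N}`).
[cite: MurtySaradha2010, Theorem 7 (proof, §9)] -/
theorem sum_div_one_sub_cexp_ne_zero (hN : N % 4 = 3) (Φ : ZMod N → ℂ)
    (hpm : ∀ b : ZMod N, b ≠ 0 → Φ b = 1 ∨ Φ b = -1) :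
    ∑ b ∈ Ico 1 N, Φ b / (1 - cexp (2 * Real.pi * I * b / N)) ≠ 0 := by
  classical
  have hN0 : 0 < N := by omega
  set w : ℕ → ℂ := fun b => 1 / (1 - cexp (2 * Real.pi * I * b / N)) with hw
  set M : Finset ℕ := (Ico 1 N).filter (fun b => Φ (b : ZMod N) = -1) with hM
  -- `Φ b · w b = w b − 2·[Φ b = −1]·w b` on `1 ≤ b < N`
  have hsplit : ∀ b ∈ Ico 1 N, Φ b / (1 - cexp (2 * Real.pi * I * b / N)) =
      w b - 2 * (if Φ (b : ZMod N) = -1 then w b else 0) := by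
    intro b hb
    obtain ⟨hb1, hbN⟩ := mem_Ico.1 hb
    have hb0 : (b : ZMod N) ≠ 0 := by
      rw [Ne, ZMod.natCast_eq_zero_iff]
      exact fun h => absurd (Nat.le_of_dvd (by omega) h) (by omega)
    rcases hpm _ hb0 with h | h
    · have : ¬ Φ (b : ZMod N) = -1 := by rw [h]; norm_num
      rw [if_neg this, h, hw]; ring
    · rw [if_pos h, h, hw]; ring
  intro hzero
  rw [Finset.sum_congr rfl hsplit, Finset.sum_sub_distrib, ← Finset.mul_sum, ← Finset.sum_filter,
    sum_one_div_one_sub_cexp hN0] at hzero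
  -- so `Σ_{b∈M} N·w b = N(N−1)/4`
  have hMsum : ∑ b ∈ M, (N : ℂ) / (1 - cexp (2 * Real.pi * I * b / N)) =
      (((N * (N - 1) : ℤ) / 4 : ℚ) : ℂ) := by
    have e : ∑ b ∈ M, (N : ℂ) / (1 - cexp (2 * Real.pi * I * b / N)) = (N : ℂ) * ∑ b ∈ M, w b := by
      rw [Finset.mul_sum]
      exact Finset.sum_congr rfl fun b _ => by rw [hw]; ring
    rw [e]
    have hN1 : (1 : ℕ) ≤ N := hN0
    push_cast [Nat.cast_sub hN1]
    linear_combination (-(N : ℂ) / 2) * hzero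
  -- … an algebraic integer
  have hint : IsIntegral ℤ (∑ b ∈ M, (N : ℂ) / (1 - cexp (2 * Real.pi * I * b / N))) := by
    refine IsIntegral.sum _ fun b hb => ?_
    have hb' := (mem_filter.1 hb).1
    obtain ⟨hb1, hbN⟩ := mem_Ico.1 hb'
    exact isIntegral_natCast_div_one_sub (cexp_pow_eq_one b) (cexp_ne_one hb1 hbN)
  rw [hMsum] at hint
  obtain ⟨y, hy⟩ := exists_int_of_isIntegral hint
  -- `4y = N(N−1)` is impossible for `N ≡ 3 (mod 4)`
  have h4 : (4 * y : ℚ) = ((N * (N - 1) : ℤ) : ℚ) := by rw [hy]; ring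
  have h4' : 4 * y = (N : ℤ) * (N - 1) := by exact_mod_cast h4
  obtain ⟨k, hk⟩ : ∃ k : ℤ, (N : ℤ) = 4 * k + 3 := ⟨N / 4, by omega⟩
  have h5 : 4 * (y - 4 * k ^ 2 - 5 * k - 1) = 2 := by
    rw [hk] at h4'
    linear_combination h4'
  have h6 : (4 * (y - 4 * k ^ 2 - 5 * k - 1)) % 4 = 2 % 4 := by rw [h5]
  rw [Int.mul_emod_right] at h6
  norm_num at h6

/-! ### Theorem 7 -/

/-- **Murty–Saradha 2010, Theorem 7 (with Theorem 5's transcendence).** For `N ≡ 3 (mod 4)` and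
`f : ℤ/N → ℂ` with `f(0) = 0`, `f(b) = ±1` for `b ≠ 0` and `Σ_b f(b) = 0`, the number `L(1,f)` is
transcendental. [cite: MurtySaradha2010, Theorem 7] -/
theorem transcendental_LFunction_one_of_three_mod_four (hN : N % 4 = 3) (Φ : ZMod N → ℂ)
    (h0 : Φ 0 = 0) (hpm : ∀ b : ZMod N, b ≠ 0 → Φ b = 1 ∨ Φ b = -1)
    (hΦ : ∑ j : ZMod N, Φ j = 0) : Transcendental ℚ (ZMod.LFunction Φ 1) := by
  have hNC : (N : ℂ) ≠ 0 := by exact_mod_cast (show N ≠ 0 by omega)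
  have halg : ∀ j, IsAlgebraic ℚ (Φ j) := by
    intro j
    by_cases hj : j = 0
    · rw [hj, h0]; exact isAlgebraic_zero
    · rcases hpm j hj with h | h
      · rw [h]; exact isAlgebraic_one
      · rw [h]; exact isAlgebraic_one.neg
  refine transcendental_LFunction_one_of_ne_zero Φ hΦ halg ?_
  rw [h0, zero_div, zero_add]
  exact mul_ne_zero (inv_ne_zero hNC) (sum_div_one_sub_cexp_ne_zero hN Φ hpm)

/-- **Murty–Saradha 2010, Theorem 7: `L(1,f) ≠ 0`.** For `N ≡ 3 (mod 4)` and `f : ℤ/N → ℂ` with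
`f(0) = 0`, `f(b) = ±1` for `b ≠ 0`, `Σ_b f(b) = 0`: `L(1,f) ≠ 0`. [cite: MurtySaradha2010, Theorem 7] -/
theorem LFunction_one_ne_zero_of_three_mod_four (hN : N % 4 = 3) (Φ : ZMod N → ℂ)
    (h0 : Φ 0 = 0) (hpm : ∀ b : ZMod N, b ≠ 0 → Φ b = 1 ∨ Φ b = -1)
    (hΦ : ∑ j : ZMod N, Φ j = 0) : ZMod.LFunction Φ 1 ≠ 0 :=
  fun h => transcendental_LFunction_one_of_three_mod_four hN Φ h0 hpm hΦ (h ▸ isAlgebraic_zero)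

/-- **Erdős's conjecture for `q ≡ 3 (mod 4)` (Murty–Saradha 2010, Theorem 7), series form, no
convergence hypothesis.** «If `f : ℤ/qℤ → ℚ` with `f(a) = ±1` and `f(q) = 0`, then
`Σ_{n=1}^{∞} f(n)/n ≠ 0`»: for `q ≡ 3 (mod 4)` the partial sums `Σ_{n ≤ M} f(n)/n` do not tend to
`0` — they tend to `L(1,f) ≠ 0` when `Σ_a f(a) = 0` and diverge otherwise
(`PeriodicLSeries.not_tendsto_sum_range_div`). [cite: MurtySaradha2010, Theorem 7] -/
theorem erdos_conjecture_three_mod_four (hN : N % 4 = 3) (Φ : ZMod N → ℂ) (h0 : Φ 0 = 0)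
    (hpm : ∀ b : ZMod N, b ≠ 0 → Φ b = 1 ∨ Φ b = -1) :
    ¬ Tendsto (fun M : ℕ => ∑ n ∈ range M, Φ ((n + 1 : ℕ) : ZMod N) / ((n + 1 : ℕ) : ℂ))
      atTop (𝓝 0) := by
  by_cases hΦ : ∑ j : ZMod N, Φ j = 0
  · exact fun h => LFunction_one_ne_zero_of_three_mod_four hN Φ h0 hpm hΦ
      (tendsto_nhds_unique (tendsto_sum_range_div Φ hΦ) h)
  · exact not_tendsto_sum_range_div Φ hΦ 0

/-! ### The other settled residues: even `q` (parity) and prime `q` (Baker–Birch–Wirsing) -/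

/-- For EVEN `N` and `f = ±1` off `0`, `f(0) = 0`, the period-sum `Σ_j f(j)` is non-zero: it is a
sum of `N − 1` (odd) signs («Looking at this equation mod 2 gives a contradiction when `q` is
even»). [cite: MurtySaradha2010, §1 (after Theorem 7)] -/
theorem sum_ne_zero_of_even (hN : Even N) (Φ : ZMod N → ℂ) (h0 : Φ 0 = 0)
    (hpm : ∀ b : ZMod N, b ≠ 0 → Φ b = 1 ∨ Φ b = -1) : ∑ j : ZMod N, Φ j ≠ 0 := by
  classical
  intro hsum
  set M : Finset (ZMod N) := (univ.erase 0).filter (fun j => Φ j = -1) with hM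
  have hsplit : ∀ j ∈ (univ : Finset (ZMod N)).erase 0,
      Φ j = 1 - 2 * (if Φ j = -1 then 1 else 0) := by
    intro j hj
    have hj0 : j ≠ 0 := (mem_erase.1 hj).1
    rcases hpm j hj0 with h | h
    · have : ¬ Φ j = -1 := by rw [h]; norm_num
      rw [if_neg this, h]; ring
    · rw [if_pos h, h]; ring
  rw [← Finset.sum_erase univ h0, Finset.sum_congr rfl hsplit, Finset.sum_sub_distrib,
    ← Finset.mul_sum, ← Finset.sum_filter, Finset.sum_const, Finset.sum_const,
    Finset.card_erase_of_mem (mem_univ _), Finset.card_univ, ZMod.card] at hsum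
  simp only [nsmul_eq_mul, mul_one] at hsum
  have hN1 : 1 ≤ N := Nat.pos_of_ne_zero (NeZero.ne N)
  rw [Nat.cast_sub hN1] at hsum
  have h : (((N - 1 : ℕ) : ℝ) : ℂ) = (((2 * M.card : ℕ) : ℝ) : ℂ) := by
    push_cast [Nat.cast_sub hN1]
    linear_combination hsum
  have h' : N - 1 = 2 * M.card := by exact_mod_cast h
  obtain ⟨k, hk⟩ := hN
  omega

/-- **Erdős's conjecture for EVEN `q`**: with `f = ±1` off `0` and `f(0) = 0` the period-sum is
non-zero, so the series `Σ f(n)/n` diverges — in particular it does not sum to `0`.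
[cite: MurtySaradha2010, §1 (after Theorem 7)] -/
theorem erdos_conjecture_even (hN : Even N) (Φ : ZMod N → ℂ) (h0 : Φ 0 = 0)
    (hpm : ∀ b : ZMod N, b ≠ 0 → Φ b = 1 ∨ Φ b = -1) :
    ¬ Tendsto (fun M : ℕ => ∑ n ∈ range M, Φ ((n + 1 : ℕ) : ZMod N) / ((n + 1 : ℕ) : ℂ))
      atTop (𝓝 0) :=
  not_tendsto_sum_range_div Φ (sum_ne_zero_of_even hN Φ h0 hpm) 0

omit [NeZero N] in
/-- **Erdős's conjecture for PRIME `q`** («We can apply their result [Baker–Birch–Wirsing] to see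
that the conjecture of Erdös holds if `q` is a prime number»): the tree's
`not_tendsto_sum_div_zero_of_rat_prime` (`BakerBirchWirsingProofs.lean`, P1 g55) at the rational-valued `f`.
[cite: MurtySaradha2010, §1 (before Theorem 7)] -/
theorem erdos_conjecture_prime (hN : N.Prime) (Φ : ZMod N → ℂ) (h0 : Φ 0 = 0)
    (hpm : ∀ b : ZMod N, b ≠ 0 → Φ b = 1 ∨ Φ b = -1) :
    ¬ Tendsto (fun M : ℕ => ∑ n ∈ range M, Φ ((n + 1 : ℕ) : ZMod N) / ((n + 1 : ℕ) : ℂ))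
      atTop (𝓝 0) := by
  classical
  haveI : Fact N.Prime := ⟨hN⟩
  -- the rational-valued copy of `Φ`
  let f : ZMod N → ℚ := fun j => if Φ j = 1 then 1 else if Φ j = -1 then -1 else 0
  have hf : ∀ j, ((f j : ℚ) : ℂ) = Φ j := by
    intro j
    by_cases hj : j = 0
    · have h1 : ¬ Φ j = 1 := by rw [hj, h0]; norm_num
      have h2 : ¬ Φ j = -1 := by rw [hj, h0]; norm_num
      dsimp only [f]
      rw [if_neg h1, if_neg h2, Rat.cast_zero, hj, h0]
    · rcases hpm j hj with h | h
      · dsimp only [f]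
        rw [if_pos h, Rat.cast_one, h]
      · have h1 : ¬ Φ j = 1 := by rw [h]; norm_num
        dsimp only [f]
        rw [if_neg h1, if_pos h, Rat.cast_neg, Rat.cast_one, h]
  have hf0 : f ≠ 0 := by
    intro hzero
    have h1 : (1 : ZMod N) ≠ 0 := one_ne_zero
    have := congrArg (fun g : ZMod N → ℚ => ((g 1 : ℚ) : ℂ)) hzero
    simp only [hf, Pi.zero_apply, Rat.cast_zero] at this
    rcases hpm 1 h1 with h | h <;> rw [h] at this <;> norm_num at this
  have h := not_tendsto_sum_div_zero_of_rat_prime f hf0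
  simp only [hf] at h
  exact h

/-- **Erdős's conjecture outside the composite moduli `q ≡ 1 (mod 4)`**: for `q` prime, or even,
or `≡ 3 (mod 4)`, and `f : ℤ/q → ℂ` with `f(0) = 0`, `f(b) = ±1` (`b ≠ 0`), the partial sums of
`Σ f(n)/n` do not tend to `0` (the prime case is Baker–Birch–Wirsing, the even case parity, the
case `q ≡ 3 (mod 4)` Theorem 7; «the only case of the Erdös conjecture that is open is when
`q ≡ 1 (mod 4)`»). [cite: MurtySaradha2010, §1 (Theorem 7 and the surrounding remarks)] -/
theorem erdos_conjecture_of_prime_or_mod_four_ne_one (hN : N.Prime ∨ N % 4 ≠ 1) (Φ : ZMod N → ℂ)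
    (h0 : Φ 0 = 0) (hpm : ∀ b : ZMod N, b ≠ 0 → Φ b = 1 ∨ Φ b = -1) :
    ¬ Tendsto (fun M : ℕ => ∑ n ∈ range M, Φ ((n + 1 : ℕ) : ZMod N) / ((n + 1 : ℕ) : ℂ))
      atTop (𝓝 0) := by
  rcases hN with hN | hN
  · exact erdos_conjecture_prime hN Φ h0 hpm
  · by_cases h3 : N % 4 = 3
    · exact erdos_conjecture_three_mod_four h3 Φ h0 hpm
    · have hE : Even N := ⟨N / 2, by omega⟩
      exact erdos_conjecture_even hE Φ h0 hpm

end MurtySaradha2010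

end Literature.NumberTheory.Transcendental
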